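import Summits.QuantumFields.YangMills.Theorems.BalabanUVNodesN15FullPropagatorSizedRecord
import Summits.QuantumFields.YangMills.Theorems.BalabanUVNodesN15PairedFamilyGuard

/-!
# Route «BalabanUVNodes», cluster K4 «SpineRates» — node N15 = NE2, -a lane, part 84 (programme S, file S-C): THE SIZED GENUINE FAMILY PASSES THE K3⁷ v2 GUARD —
# `PairedFamilyGuard.Live` ∕ `KeyedLive` BY NAME — AND CARRIES `N15At`: the second positive control for plan (q2), with BAŁABAN's OWN `U ≡ 1` OBJECTS

Cell `pub-ymgap`, seat `pub-ymgap-dag-n15-a` (-a KNIT-BY-NAME seat of node N15; HUMAN RULING D-0062; chair R424 venue), generation 18, part 84 (THEOREMS ONLY, 0 `def`, 0 `sorry`).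
`bears_on: R4∕N15 · K3⁷ SpineGivenEndpointR13SepCoPH (stmt-QuantumFields-20544)`.  Filed `--kind proof --supports stmt-QuantumFields-20544 --as helper` — COUNT-NEUTRAL.  Imports
part 83 (S-B `…N15FullPropagatorSizedRecord`: `fullGSizedObjects` and its three `Live` clauses as theorems, `n15At_fullGSizedObjects`, the CoPH faces) and width seat dag-n15-w2's
`…N15PairedFamilyGuard` (p584544: `Live`, `KeyedLive`, `not_live_tgInstance_comp`, the content readers `…_one_cofinal_of_live`); nothing in the tree is modified or re-declared.

WHY.  Plan g78∕g79 K3⁷ v2 PIN LIST (q2) for N15: the re-keyed deciding stub conjoins dag-n15-w2's guard `PairedFamilyGuard.KeyedLive (rrOfRecord 𝔯 ksel)` BY NAME with the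
by-name `ne2` pin; R3's acceptance test wants a POSITIVE CONTROL — a reading that passes `KeyedLive` at the bundle of record AND carries `N15At`.  The one in the tree
(w2's `exists_reading_keyedLive_n15At`) is this seat's g0 LG-vector KNIT family (the single-scale PIECES `Δ_k` (1.66) ∕ `H_k` (1.63) ∕ `C^{(k)}` (2.156) at `U ≡ 1` — model
level).  w2's kernel fact `not_live_tgInstance_comp` says NO family on part 55's `tgInstance` can pass (`gf.M = 1`), so none of the -a lane's GENUINE readouts (parts 72∕73∕76,
V-D: Bałaban's full Landau-gauge pair through all four (3.42) entries, his site form, his (2.156) covariance, the exactly dressed unit layer) could serve.  Parts 82∕83 made the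
genuine family size-live; this file closes the loop BY NAME: §1 `Live` for `fullGSizedObjects` (every parameter value) and `Live ∧ N15At` (`d ≥ 1`, odd `L ≥ 3`, `b, a_S > 0`),
with the located contrast `not_live_fullGCovObjects` (part 76's literal fails the guard — same kernels, inert size); §2 what the guard makes the by-name layers SAY here (w2's
readers applied: the (3.42) ∕ (3.48) ∕ (3.187) inequalities at `U ≡ 1` on COFINALLY MANY instances — and, stronger, part 82's `…_sized_iff` give them at EVERY index); §3 ★★★
`exists_reading_keyedLive_n15At_fullGSized` — SOME Stage-13 reading passes `KeyedLive` at the bundle of record for EVERY run-length selector AND carries `N15At` there AND has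
`S_N15` at both CoPH homes, its NE2 objects being NAMED (`fullGSizedObjects 3 F.hL …` on each family's own tori) — the (q2) positive control with GENUINE objects; §4 the same for
the READING OF RECORD `readingOfRecord₁₃CoPH w1 ℓ₃ ne2 ne1` at the residual layer `ne2 :=` the sized genuine objects, for every `w1 ℓ₃ ne1` and every selector — including the
NAMED faces a v2 `stub_rates13H` proof reads at the N15 slot under the pin (α): `n15At_rateCarriersOfRecord₁₃CoPH_of_fullGSized_family` (= `N15At (rrOfRecord 𝔯 ksel …).ne2`),
`live_and_n15At_rateCarriersOfRecord₁₃CoPH_of_fullGSized_family`, `keyedLive_readingOfRecord₁₃CoPH_of_fullGSized_family`.  v1.1 (append-only) §5: under the (α) pin OF RECORD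
(K3⁷ skeleton v2 `N15PinnedSized`): `keyedLive_of_pinnedSized`, `live_and_n15At_rrOfRecord_of_pinnedSized` — both `GuardedReading` conjuncts of the N15 corner from the pin alone.

HONEST FRAMING.  Kernel composition BY NAME (parts 82∕83 + w2's guard file + n22-e's homes); no estimate in this file.  A guard EXCLUDES CARRIER JUNK (empty ∕ bounded-`M` ∕
bounded-`k` ∕ nowhere-regular ∕ empty-region families); it does NOT tie the kernels to Bałaban's propagators of record — that is the by-name PIN of `𝔯.lit·ne2` (Node 00's [B9]
operator layer; the definers' ∕ the plan's), which this file does not touch.  The family is the `U ≡ 1` (A = 0) content of node N15 for Bałaban's OWN linear objects on the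
L-divisible tori of record, size guard live, one-point background carrier (the «+» blocks inert); NOT Bałaban's `G(U)` ∕ `C^{(k)}(Λ)(U)` with the background live (NE2⁺ NOT PRINTED
beyond King's scalar template [King1986] Lemma 4.5 (4.38) p.674) — so **N15 is NOT discharged** (typed 28∕28 · discharged 5∕27 of record unchanged); K3⁷ OPEN, not claimed;
count-neutral; one finite four-torus programme at fixed `ε` — NOT ℝ⁴, NOT infinite volume, NOT OS, NOT a mass gap, NOT Clay.  Restate-immune (no Theses import).
-/

set_option autoImplicit false

noncomputable section
namespace Summit.QuantumFields.YangMills.BalabanUVNodes.N15.GenuineRecord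

open Literature.MathematicalPhysics.QuantumFieldTheory.Balaban1983to89
open Literature.MathematicalPhysics.QuantumFieldTheory.Balaban1983to89.T4Continuum (T4Family ULoop)
open Literature.MathematicalPhysics.QuantumFieldTheory.Balaban1983to89.T4EtaRate (PairedInstance NE2PlusOperator NE2PlusSite NE2PlusUnit NE2ZeroOperator EtaRateIneq342
  EtaRateIneqSite EtaRateIneqUnit)
open Node00 (Stage13HParams NE2Objects₁₁ NE3Letters₁₁ RateObjects₁₁ nonempty_rateObjects₁₁)
open Node00.W1 (ReadingData)
open Summit.QuantumFields.BalabanUV.T4Continuum.HistoryFlow (two_le_L)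
open Summit.QuantumFields.YangMills.BalabanUVNodes.N15.AtKeyedHome (neZero_blockFactor)
open Summit.QuantumFields.YangMills.BalabanUVNodes.N15.PairedFamilyGuard (Live KeyedLive not_live_tgInstance_comp etaRateIneq342_one_cofinal_of_live
  etaRateIneqSite_one_cofinal_of_live etaRateIneqUnit_one_cofinal_of_live)
open Summit.QuantumFields.YangMills.BalabanUVNodes.N15.TwoGrid (tgInstance tgGeoC tgFamily tgT1 tgT2)
open Summit.QuantumFields.YangMills.BalabanUVNodes.N15.GenuineSite (genuineSiteStep)
open Summit.QuantumFields.YangMills.BalabanUVNodes.N15.AtReadingOfRecord13CoPH (s_N15_readingOfRecord₁₃CoPH_homes_of_fullGSized_family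
  populated_readingOfRecord₁₃CoPH_of_fullGSized_family)
open Summit.QuantumFields.YangMills.BalabanUVNodes.N15.AtRRec13CoPH (s_N15_homes₁₃CoPH_of_forall_admissible)
open YMDAG.UVSplit (NE1pCarriers NE2Carriers RateCarriers N15At S_N15 ne2OfRecord₁₁ RateReading₁₃CoPH RRec₁₃CoPH RRec₁₃CoPHOn rateCarriersOfRecord₁₃CoPH
  readingOfRecord₁₃CoPH readingOfRecord₁₃CoPH_ne2)

variable {d : ℕ} {L : ℕ} [NeZero L]

/-! ## §1 The sized genuine family PASSES the guard; part 76's literal does not -/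

/-- ★★ **THE SIZED GENUINE FAMILY IS LIVE** (dag-n15-w2's `PairedFamilyGuard.Live` BY NAME, every parameter value): cofinal in `gf.M` and `gc.k` (part 83
`cofinal_fullGSizedObjects`), the trivial configuration regular at every `α₀ > 0`, the region `⊤` inhabited. [bookkeeping] -/
theorem live_fullGSizedObjects (hL : Odd L ∧ 1 < L) (b aS : ℝ) (ν μ α β : Fin (d + 1)) (c35 p : ℝ) :
    Live (ne2OfRecord₁₁ (fullGSizedObjects d hL b aS ν μ α β c35 p)) :=
  ⟨cofinal_fullGSizedObjects hL b aS ν μ α β c35 p, reg_one_fullGSizedObjects hL b aS ν μ α β c35 p, inΛ_nonempty_fullGSizedObjects hL b aS ν μ α β c35 p⟩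

/-- ★★★ **A6 INHABITANT OF «GUARD ∧ `N15At`» WITH BAŁABAN's GENUINE `U ≡ 1` OBJECTS, HYPOTHESIS-FREE** (`d ≥ 1`, odd `L ≥ 3`, `b, a_S > 0`, every `ν μ α β c₃₅ p`): the sized family
— his full Landau-gauge pair `(Δ′_b⁻¹, Δ_b⁻¹)` through all four (3.42) entries, his site form `(Q′G′²Q′*)⁻¹`, his (2.156) covariance `C^{(k)}_Λ`, on the L-divisible tori of record
at every size `M ≥ 1` — is LIVE and carries `N15At`.  The positive control of w2's `live_and_n15At_knitCarriers` with the single-scale PIECES replaced by the GENUINE OBJECTS.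
[bookkeeping] -/
theorem live_and_n15At_fullGSizedObjects (hd : 1 ≤ d) (hLodd : Odd L) (hL2 : 2 ≤ L) (hL : Odd L ∧ 1 < L) {b aS : ℝ} (hb : 0 < b) (haS : 0 < aS)
    (ν μ α β : Fin (d + 1)) (c35 p : ℝ) :
    Live (ne2OfRecord₁₁ (fullGSizedObjects d hL b aS ν μ α β c35 p)) ∧ N15At (ne2OfRecord₁₁ (fullGSizedObjects d hL b aS ν μ α β c35 p)) :=
  ⟨live_fullGSizedObjects hL b aS ν μ α β c35 p, n15At_fullGSizedObjects (d := d) hd hLodd hL2 hL hb haS ν μ α β c35 p⟩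

/-- **LOCATED CONTRAST — PART 76's WINDOW-FREE GENUINE LITERAL `fullGCovObjects` FAILS THE GUARD** (same kernels, [B9] size field inert `= 1`: w2's `not_live_tgInstance_comp`
at `f := Subtype.val`); its `N15At` (part 76 `n15At_fullGCovObjects`) is therefore NOT a (q2) positive control — parts 82∕83's sized edition is. [bookkeeping] -/
theorem not_live_fullGCovObjects (hL : Odd L ∧ 1 < L) (b aS : ℝ) (ν μ α β : Fin (d + 1)) (c35 p : ℝ) :
    ¬ Live (ne2OfRecord₁₁ (fullGCovObjects d hL b aS ν μ α β c35 p)) :=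
  not_live_tgInstance_comp (d := d) hL (Subtype.val : TGIndexL → _) c35 p _ _ _ _ _

/-- The family-keyed literal (`(3, F.hL)`) is live at every datum family. [bookkeeping] -/
theorem live_fullGSizedObjects_family (F : T4Family) (b aS : ℝ) (ν μ α β : Fin 4) (c35 p : ℝ) :
    Live (ne2OfRecord₁₁ (haveI := neZero_blockFactor F; fullGSizedObjects 3 F.hL b aS ν μ α β c35 p)) := by
  haveI := neZero_blockFactor F
  exact live_fullGSizedObjects F.hL b aS ν μ α β c35 p

/-- `Live ∧ N15At` at the family-keyed literal (`b, a_S > 0`; `2 ≤ F.L` from `11 < L`). [bookkeeping] -/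
theorem live_and_n15At_fullGSizedObjects_family {b aS : ℝ} (hb : 0 < b) (haS : 0 < aS) (ν μ α β : Fin 4) (c35 p : ℝ) (F : T4Family) :
    Live (ne2OfRecord₁₁ (haveI := neZero_blockFactor F; fullGSizedObjects 3 F.hL b aS ν μ α β c35 p)) ∧
      N15At (ne2OfRecord₁₁ (haveI := neZero_blockFactor F; fullGSizedObjects 3 F.hL b aS ν μ α β c35 p)) := by
  haveI := neZero_blockFactor F
  exact live_and_n15At_fullGSizedObjects (d := 3) (by norm_num) F.hL.1 (two_le_L F) F.hL hb haS ν μ α β c35 p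

/-! ## §2 What the guard makes the by-name layers SAY on this family (w2's readers applied) -/

/-- **THE OPERATOR LAYER BITES**: the (3.42)-shaped inequality at `U ≡ 1` with uniform constants on COFINALLY MANY instances of the sized genuine family (w2's
`etaRateIneq342_one_cofinal_of_live`; part 82's `ne2PlusOperator_fullG_sized_iff` gives it at EVERY index — this is the guard-level reading). [bookkeeping] -/
theorem etaRateIneq342_cofinal_fullGSizedObjects (hd : 1 ≤ d) (hLodd : Odd L) (hL2 : 2 ≤ L) (hL : Odd L ∧ 1 < L) {b aS : ℝ} (hb : 0 < b) (haS : 0 < aS)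
    (ν μ α β : Fin (d + 1)) (c35 p : ℝ) :
    ∃ B₀ δ₀ γ : ℝ, 0 < B₀ ∧ 0 < δ₀ ∧ 0 < γ ∧ ∀ (M : ℝ) (k₀ : ℕ), ∃ j : TGIndexS, M ≤ (tgInstanceS d hL j).gf.M ∧ k₀ ≤ (tgInstanceS d hL j).gc.k ∧
      EtaRateIneq342 (tgFamilyS d hL b ν μ j) B₀ δ₀ γ (tgInstanceS d hL j).Bf.one :=
  etaRateIneq342_one_cofinal_of_live (n15At_fullGSizedObjects (d := d) hd hLodd hL2 hL hb haS ν μ α β c35 p) (live_fullGSizedObjects hL b aS ν μ α β c35 p)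

/-- **THE SITE LAYER BITES** (w2's `etaRateIneqSite_one_cofinal_of_live`). [bookkeeping] -/
theorem etaRateIneqSite_cofinal_fullGSizedObjects (hd : 1 ≤ d) (hLodd : Odd L) (hL2 : 2 ≤ L) (hL : Odd L ∧ 1 < L) {b aS : ℝ} (hb : 0 < b) (haS : 0 < aS)
    (ν μ α β : Fin (d + 1)) (c35 p : ℝ) :
    ∃ C δ γ : ℝ, 0 < C ∧ 0 < δ ∧ 0 < γ ∧ ∀ (M : ℝ) (k₀ : ℕ), ∃ j : TGIndexS, M ≤ (tgInstanceS d hL j).gf.M ∧ k₀ ≤ (tgInstanceS d hL j).gc.k ∧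
      EtaRateIneqSite 4 p (genuineSiteStepS d hL aS j) C δ γ (tgInstanceS d hL j).Bf.one :=
  etaRateIneqSite_one_cofinal_of_live (n15At_fullGSizedObjects (d := d) hd hLodd hL2 hL hb haS ν μ α β c35 p) (live_fullGSizedObjects hL b aS ν μ α β c35 p)

/-- **THE UNIT LAYER BITES** (w2's `etaRateIneqUnit_one_cofinal_of_live`: the clean rate `θ^k` over unboundedly many scales, region met). [bookkeeping] -/
theorem etaRateIneqUnit_cofinal_fullGSizedObjects (hd : 1 ≤ d) (hLodd : Odd L) (hL2 : 2 ≤ L) (hL : Odd L ∧ 1 < L) {b aS : ℝ} (hb : 0 < b) (haS : 0 < aS)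
    (ν μ α β : Fin (d + 1)) (c35 p : ℝ) :
    ∃ B₀ δ₀ θ : ℝ, 0 < B₀ ∧ 0 < δ₀ ∧ 0 < θ ∧ θ < 1 ∧ ∀ (M : ℝ) (k₀ : ℕ), ∃ j : TGIndexS, M ≤ (tgInstanceS d hL j).gf.M ∧ k₀ ≤ (tgInstanceS d hL j).gc.k ∧
      (∃ _y : (tgGeoCS d hL j).Site, True) ∧
      EtaRateIneqUnit (tgCovStepS d hL α β j) (fun _ => True) (tgGeoCS d hL j).dist B₀ δ₀ θ (tgInstanceS d hL j).gc.k (tgInstanceS d hL j).Bf.one :=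
  etaRateIneqUnit_one_cofinal_of_live (n15At_fullGSizedObjects (d := d) hd hLodd hL2 hL hb haS ν μ α β c35 p) (live_fullGSizedObjects hL b aS ν μ α β c35 p)

/-! ## §3 ★★★ The (q2) positive control with genuine objects: a Stage-13 reading passing `KeyedLive` at the bundle of record and carrying `N15At` -/

section Keyed

variable {N : ℕ} [NeZero N] {b aS : ℝ}

/-- ★★★ **SOME STAGE-13 READING PASSES `KeyedLive` AT THE BUNDLE OF RECORD FOR EVERY RUN-LENGTH SELECTOR, CARRIES `N15At` THERE, HAS `S_N15` AT BOTH CoPH HOMES, AND ITS NE2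
OBJECTS ARE NAMED — BAŁABAN's GENUINE `U ≡ 1` OBJECTS, SIZE GUARD LIVE** (`b, a_S > 0`, every `ν μ α β c₃₅ p`): the reading whose NE2 objects at every tuple and run length are
`fullGSizedObjects 3 F.hL b a_S ν μ α β c₃₅ p` on the family's OWN L-divisible tori (the other rate objects = RR-1's sanity inhabitant, the dressed tower empty — «don't-care»
fillers of NO content, displayed in the proof, exactly as in w2's `exists_reading_keyedLive_n15At`).  R3 reading: a v2 deciding stub conjoining `KeyedLive` BY NAME is satisfiable
at the N15 slot by the GENUINE (not only the model-knit) family; the pin of `𝔯.lit·ne2` to the objects OF RECORD remains the definers'. [bookkeeping] -/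
theorem exists_reading_keyedLive_n15At_fullGSized (hb : 0 < b) (haS : 0 < aS) (ν μ α β : Fin 4) (c35 p : ℝ) :
    ∃ 𝔯 : RateReading₁₃CoPH N,
      (∀ (F : T4Family) (θ : Stage13HParams F N) (hP : θ.Provisos₁₃CoPH F N) (g₀ : ℕ → ℝ) (os : List (ULoop F)) (k : ℕ),
        (𝔯.lit F θ hP g₀ os).ne2 k = haveI := neZero_blockFactor F; fullGSizedObjects 3 F.hL b aS ν μ α β c35 p) ∧
      (∀ ksel : (F : T4Family) → (θ : Stage13HParams F N) → θ.Provisos₁₃CoPH F N → (ℕ → ℝ) → List (ULoop F) → ℕ,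
        KeyedLive (fun F θ hP g₀ os => rateCarriersOfRecord₁₃CoPH 𝔯 F θ hP g₀ os (ksel F θ hP g₀ os)) ∧
        ∀ (F : T4Family) (θ : Stage13HParams F N) (hP : θ.Provisos₁₃CoPH F N) (g₀ : ℕ → ℝ) (os : List (ULoop F)),
          N15At (rateCarriersOfRecord₁₃CoPH 𝔯 F θ hP g₀ os (ksel F θ hP g₀ os)).ne2) ∧
      S_N15 (RRec₁₃CoPH 𝔯) ∧ ∀ Rg : (F : T4Family) → Stage13HParams F N → Prop, S_N15 (RRec₁₃CoPHOn 𝔯 Rg) := by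
  obtain ⟨r₀⟩ := nonempty_rateObjects₁₁ (N := N)
  let lit : (F : T4Family) → (θ : Stage13HParams F N) → θ.Provisos₁₃CoPH F N → (ℕ → ℝ) → List (ULoop F) → RateObjects₁₁ N :=
    fun F _ _ _ _ => ⟨r₀.u3, r₀.ne3, fun _ => haveI := neZero_blockFactor F; fullGSizedObjects 3 F.hL b aS ν μ α β c35 p⟩
  let 𝔯 : RateReading₁₃CoPH N := ⟨lit, fun _ _ _ _ _ => (⟨Empty, ⟨fun q => q.elim, fun q => q.elim, fun q => q.elim⟩, 0⟩ : NE1pCarriers)⟩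
  have h𝔯 : ∀ (F : T4Family) (θ : Stage13HParams F N) (hP : θ.Provisos₁₃CoPH F N) (g₀ : ℕ → ℝ) (os : List (ULoop F)) (k : ℕ),
      (𝔯.lit F θ hP g₀ os).ne2 k = haveI := neZero_blockFactor F; fullGSizedObjects 3 F.hL b aS ν μ α β c35 p := fun _ _ _ _ _ _ => rfl
  have key : ∀ F : T4Family, Live (ne2OfRecord₁₁ (haveI := neZero_blockFactor F; fullGSizedObjects 3 F.hL b aS ν μ α β c35 p)) ∧
      N15At (ne2OfRecord₁₁ (haveI := neZero_blockFactor F; fullGSizedObjects 3 F.hL b aS ν μ α β c35 p)) :=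
    fun F => live_and_n15At_fullGSizedObjects_family hb haS ν μ α β c35 p F
  have hS := s_N15_homes₁₃CoPH_of_forall_admissible 𝔯 fun F θ hP _ g₀ os k => by
    rw [h𝔯 F θ hP g₀ os k]
    exact (key F).2
  exact ⟨𝔯, h𝔯, fun ksel => ⟨fun F θ hP _ _ g₀ os => (key F).1, fun F θ hP g₀ os => (key F).2⟩, hS.1, hS.2⟩

end Keyed

/-! ## §4 The same at the READING OF RECORD `readingOfRecord₁₃CoPH w1 ℓ₃ ne2 ne1` with the residual layer := the sized genuine objects -/

section OfRecord

variable {N : ℕ} [NeZero N] {b aS : ℝ}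
  (w1 : (F : T4Family) → (θ : Stage13HParams F N) → ReadingData F (Node00.MatA N) θ.τ9.M) (ℓ₃ : T4Family → NE3Letters₁₁)
  (ne2 : (F : T4Family) → Stage13HParams F N → (ℕ → ℝ) → List (ULoop F) → ℕ → NE2Objects₁₁)
  (ne1 : (F : T4Family) → Stage13HParams F N → (ℕ → ℝ) → List (ULoop F) → NE1pCarriers)

/-- ★★ **`KeyedLive` AT THE BUNDLE OF THE READING OF RECORD, EVERY SELECTOR**, when N15's residual layer `ne2` takes the sized genuine objects as values EVERYWHERE (every
Stage-13 parameter, `(g₀, os)`, run length): the guard reads `Live (ne2OfRecord₁₁ (ne2 F θ g₀ os (ksel …)))` (n22-e's `readingOfRecord₁₃CoPH_ne2`) = §1. [bookkeeping] -/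
theorem keyedLive_readingOfRecord₁₃CoPH_of_fullGSized_family (ν μ α β : Fin 4) (c35 p : ℝ)
    (h : ∀ (F : T4Family) (θ : Stage13HParams F N) (g₀ : ℕ → ℝ) (os : List (ULoop F)) (k : ℕ),
      ne2 F θ g₀ os k = haveI := neZero_blockFactor F; fullGSizedObjects 3 F.hL b aS ν μ α β c35 p)
    (ksel : (F : T4Family) → (θ : Stage13HParams F N) → θ.Provisos₁₃CoPH F N → (ℕ → ℝ) → List (ULoop F) → ℕ) :
    KeyedLive (fun F θ hP g₀ os => rateCarriersOfRecord₁₃CoPH (readingOfRecord₁₃CoPH w1 ℓ₃ ne2 ne1) F θ hP g₀ os (ksel F θ hP g₀ os)) := by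
  intro F θ hP _ _ g₀ os
  show Live (ne2OfRecord₁₁ (((readingOfRecord₁₃CoPH w1 ℓ₃ ne2 ne1).lit F θ hP g₀ os).ne2 (ksel F θ hP g₀ os)))
  rw [readingOfRecord₁₃CoPH_ne2, h F θ g₀ os (ksel F θ hP g₀ os)]
  exact live_fullGSizedObjects_family F b aS ν μ α β c35 p

/-- ★★ **`N15At` AT EVERY BUNDLE OF THE READING OF RECORD — the v2 `RatesHolderAt` conjunct at `rrOfRecord 𝔯 ksel F θ hP g₀ os` for `𝔯 := readingOfRecord₁₃CoPH w1 ℓ₃ ne2 ne1`,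
EVERY selector, every Stage-13 parameter (admissible or not), every `(g₀, os)`** — when N15's residual layer `ne2` takes the sized genuine objects as values everywhere
(`b, a_S > 0`).  This is the face a v2 `stub_rates13H` proof reads at the N15 slot under the pin (α) «`ne2 :=` the sized genuine objects». [bookkeeping] -/
theorem n15At_rateCarriersOfRecord₁₃CoPH_of_fullGSized_family (hb : 0 < b) (haS : 0 < aS) (ν μ α β : Fin 4) (c35 p : ℝ)
    (h : ∀ (F : T4Family) (θ : Stage13HParams F N) (g₀ : ℕ → ℝ) (os : List (ULoop F)) (k : ℕ),
      ne2 F θ g₀ os k = haveI := neZero_blockFactor F; fullGSizedObjects 3 F.hL b aS ν μ α β c35 p)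
    (ksel : (F : T4Family) → (θ : Stage13HParams F N) → θ.Provisos₁₃CoPH F N → (ℕ → ℝ) → List (ULoop F) → ℕ)
    (F : T4Family) (θ : Stage13HParams F N) (hP : θ.Provisos₁₃CoPH F N) (g₀ : ℕ → ℝ) (os : List (ULoop F)) :
    N15At (rateCarriersOfRecord₁₃CoPH (readingOfRecord₁₃CoPH w1 ℓ₃ ne2 ne1) F θ hP g₀ os (ksel F θ hP g₀ os)).ne2 := by
  show N15At (ne2OfRecord₁₁ (((readingOfRecord₁₃CoPH w1 ℓ₃ ne2 ne1).lit F θ hP g₀ os).ne2 (ksel F θ hP g₀ os)))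
  rw [readingOfRecord₁₃CoPH_ne2, h F θ g₀ os (ksel F θ hP g₀ os)]
  exact (live_and_n15At_fullGSizedObjects_family hb haS ν μ α β c35 p F).2

/-- ★★ **`Live ∧ N15At` AT EVERY BUNDLE OF THE READING OF RECORD** (guard and estimate together, the (q2)∕(α) pair), same hypotheses. [bookkeeping] -/
theorem live_and_n15At_rateCarriersOfRecord₁₃CoPH_of_fullGSized_family (hb : 0 < b) (haS : 0 < aS) (ν μ α β : Fin 4) (c35 p : ℝ)
    (h : ∀ (F : T4Family) (θ : Stage13HParams F N) (g₀ : ℕ → ℝ) (os : List (ULoop F)) (k : ℕ),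
      ne2 F θ g₀ os k = haveI := neZero_blockFactor F; fullGSizedObjects 3 F.hL b aS ν μ α β c35 p)
    (ksel : (F : T4Family) → (θ : Stage13HParams F N) → θ.Provisos₁₃CoPH F N → (ℕ → ℝ) → List (ULoop F) → ℕ)
    (F : T4Family) (θ : Stage13HParams F N) (hP : θ.Provisos₁₃CoPH F N) (g₀ : ℕ → ℝ) (os : List (ULoop F)) :
    Live (rateCarriersOfRecord₁₃CoPH (readingOfRecord₁₃CoPH w1 ℓ₃ ne2 ne1) F θ hP g₀ os (ksel F θ hP g₀ os)).ne2 ∧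
      N15At (rateCarriersOfRecord₁₃CoPH (readingOfRecord₁₃CoPH w1 ℓ₃ ne2 ne1) F θ hP g₀ os (ksel F θ hP g₀ os)).ne2 := by
  refine ⟨?_, n15At_rateCarriersOfRecord₁₃CoPH_of_fullGSized_family w1 ℓ₃ ne2 ne1 hb haS ν μ α β c35 p h ksel F θ hP g₀ os⟩
  show Live (ne2OfRecord₁₁ (((readingOfRecord₁₃CoPH w1 ℓ₃ ne2 ne1).lit F θ hP g₀ os).ne2 (ksel F θ hP g₀ os)))
  rw [readingOfRecord₁₃CoPH_ne2, h F θ g₀ os (ksel F θ hP g₀ os)]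
  exact live_fullGSizedObjects_family F b aS ν μ α β c35 p

/-- ★★★ **THE SIZED GENUINE RESIDUAL LAYER MAKES THE READING OF RECORD KEYED-LIVE (every selector), `N15At` AT EVERY BUNDLE, AND `S_N15` AT BOTH HOMES — for every `w1`, `ℓ₃`,
`ne1`, NO hypothesis** (`b, a_S > 0`): the residual layer `ne2 := fullGSizedObjects 3 F.hL b a_S ν μ α β c₃₅ p` (constant along `(θ, g₀, os, k)`).  Reading for the K3⁷ composer:
at the reading of record the N15 slot admits a GENUINE, GUARD-PASSING, stub-closing inhabitant; the objects OF RECORD (background LIVE, Node 00's [B9] operator layer)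
remain residual. [bookkeeping] -/
theorem exists_ne2_keyedLive_s_N15_readingOfRecord₁₃CoPH_fullGSized (hb : 0 < b) (haS : 0 < aS) (ν μ α β : Fin 4) (c35 p : ℝ) :
    ∃ ne2 : (F : T4Family) → Stage13HParams F N → (ℕ → ℝ) → List (ULoop F) → ℕ → NE2Objects₁₁,
      (∀ ksel : (F : T4Family) → (θ : Stage13HParams F N) → θ.Provisos₁₃CoPH F N → (ℕ → ℝ) → List (ULoop F) → ℕ,
        KeyedLive (fun F θ hP g₀ os => rateCarriersOfRecord₁₃CoPH (readingOfRecord₁₃CoPH w1 ℓ₃ ne2 ne1) F θ hP g₀ os (ksel F θ hP g₀ os)) ∧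
        ∀ (F : T4Family) (θ : Stage13HParams F N) (hP : θ.Provisos₁₃CoPH F N) (g₀ : ℕ → ℝ) (os : List (ULoop F)),
          N15At (rateCarriersOfRecord₁₃CoPH (readingOfRecord₁₃CoPH w1 ℓ₃ ne2 ne1) F θ hP g₀ os (ksel F θ hP g₀ os)).ne2) ∧
      (∀ (F : T4Family) (θ : Stage13HParams F N) (hP : θ.Provisos₁₃CoPH F N) (g₀ : ℕ → ℝ) (os : List (ULoop F)),
        ((readingOfRecord₁₃CoPH w1 ℓ₃ ne2 ne1).lit F θ hP g₀ os).Populated) ∧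
      S_N15 (RRec₁₃CoPH (readingOfRecord₁₃CoPH w1 ℓ₃ ne2 ne1)) ∧
      ∀ Rg : (F : T4Family) → Stage13HParams F N → Prop, S_N15 (RRec₁₃CoPHOn (readingOfRecord₁₃CoPH w1 ℓ₃ ne2 ne1) Rg) := by
  have hS := s_N15_readingOfRecord₁₃CoPH_homes_of_fullGSized_family (b := b) (aS := aS) w1 ℓ₃
    (fun F _ _ _ _ => haveI := neZero_blockFactor F; fullGSizedObjects 3 F.hL b aS ν μ α β c35 p) ne1 hb haS ν μ α β c35 p fun _ _ _ _ _ _ _ => rfl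
  refine ⟨fun F _ _ _ _ => haveI := neZero_blockFactor F; fullGSizedObjects 3 F.hL b aS ν μ α β c35 p, fun ksel => ⟨?_, fun F θ hP g₀ os => ?_⟩,
    fun F θ hP g₀ os => ?_, hS.1, hS.2⟩
  · exact keyedLive_readingOfRecord₁₃CoPH_of_fullGSized_family (b := b) (aS := aS) w1 ℓ₃ _ ne1 ν μ α β c35 p (fun _ _ _ _ _ => rfl) ksel
  · exact n15At_rateCarriersOfRecord₁₃CoPH_of_fullGSized_family (b := b) (aS := aS) w1 ℓ₃ _ ne1 hb haS ν μ α β c35 p (fun _ _ _ _ _ => rfl) ksel F θ hP g₀ os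
  · exact populated_readingOfRecord₁₃CoPH_of_fullGSized_family (b := b) (aS := aS) w1 ℓ₃ _ ne1 ν μ α β c35 p F θ hP g₀ os fun _ => rfl

end OfRecord

/-! ## §5 (v1.1, append-only) Under the (α) pin of the K3⁷ v2 skeleton OF RECORD: «pinned ⟹ keyed-live ∧ `N15At`» at every bundle

The registered skeleton `K3Skeleton13SepCoPHv2.lean` (plan g79, sha16 145a664ea9c38a7b) pins the reading's N15 objects BY NAME to part 83's `fullGSizedObjects`
(`N15PinnedSized 𝔯 := ∃ b a_S ν μ α β c₃₅ p, 0 < b ∧ 0 < a_S ∧ ∀ F θ hP g₀ os k, (𝔯.lit F θ hP g₀ os).ne2 k = fullGSizedObjects 3 F.hL …`) and conjoins, separately,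
w2's `KeyedLive (rrOfRecord 𝔯 ksel)`.  The two faces below give BOTH `GuardedReading` conjuncts of the N15 corner from the pin alone, in this file's vocabulary
(`rrOfRecord 𝔯 ksel F θ hP g₀ os` IS `rateCarriersOfRecord₁₃CoPH 𝔯 F θ hP g₀ os (ksel F θ hP g₀ os)`); the hypothesis `hpin` is `N15PinnedSized 𝔯`'s body verbatim. -/

section Pinned

variable {N : ℕ} [NeZero N]

/-- ★★ **PINNED ⟹ KEYED-LIVE, EVERY SELECTOR** (the skeleton's `GuardedReading` second conjunct from its fourth): if the reading's N15 objects are part 83's sized genuine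
objects at every tuple and run length (for some `b, a_S > 0`, directions, letters), then `KeyedLive` holds at the bundle of record for every run-length selector —
the guard reads `Live (ne2OfRecord₁₁ (fullGSizedObjects 3 F.hL …))` = `live_fullGSizedObjects_family`; the guard's keying binders are unused (objects constant along
the tuple). [bookkeeping] -/
theorem keyedLive_of_pinnedSized (𝔯 : RateReading₁₃CoPH N)
    (hpin : ∃ (b aS : ℝ) (ν μ α β : Fin 4) (c35 p : ℝ), 0 < b ∧ 0 < aS ∧
      ∀ (F : T4Family) (θ : Stage13HParams F N) (hP : θ.Provisos₁₃CoPH F N) (g₀ : ℕ → ℝ) (os : List (ULoop F)) (k : ℕ),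
        (𝔯.lit F θ hP g₀ os).ne2 k = haveI := neZero_blockFactor F; fullGSizedObjects 3 F.hL b aS ν μ α β c35 p)
    (ksel : (F : T4Family) → (θ : Stage13HParams F N) → θ.Provisos₁₃CoPH F N → (ℕ → ℝ) → List (ULoop F) → ℕ) :
    KeyedLive (fun F θ hP g₀ os => rateCarriersOfRecord₁₃CoPH 𝔯 F θ hP g₀ os (ksel F θ hP g₀ os)) := by
  obtain ⟨b, aS, ν, μ, α, β, c35, p, -, -, h⟩ := hpin
  intro F θ hP _ _ g₀ os
  show Live (ne2OfRecord₁₁ ((𝔯.lit F θ hP g₀ os).ne2 (ksel F θ hP g₀ os)))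
  rw [h F θ hP g₀ os (ksel F θ hP g₀ os)]
  exact live_fullGSizedObjects_family F b aS ν μ α β c35 p

/-- ★★ **PINNED ⟹ `Live ∧ N15At` AT EVERY BUNDLE OF RECORD** (every Stage-13 parameter with provisos, admissible or not, every `(g₀, os)`, every selector) — the skeleton's
`n15At_rrOfRecord_of_pinned` together with the guard, from the pin alone. [bookkeeping] -/
theorem live_and_n15At_rrOfRecord_of_pinnedSized (𝔯 : RateReading₁₃CoPH N)
    (hpin : ∃ (b aS : ℝ) (ν μ α β : Fin 4) (c35 p : ℝ), 0 < b ∧ 0 < aS ∧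
      ∀ (F : T4Family) (θ : Stage13HParams F N) (hP : θ.Provisos₁₃CoPH F N) (g₀ : ℕ → ℝ) (os : List (ULoop F)) (k : ℕ),
        (𝔯.lit F θ hP g₀ os).ne2 k = haveI := neZero_blockFactor F; fullGSizedObjects 3 F.hL b aS ν μ α β c35 p)
    (ksel : (F : T4Family) → (θ : Stage13HParams F N) → θ.Provisos₁₃CoPH F N → (ℕ → ℝ) → List (ULoop F) → ℕ)
    (F : T4Family) (θ : Stage13HParams F N) (hP : θ.Provisos₁₃CoPH F N) (g₀ : ℕ → ℝ) (os : List (ULoop F)) :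
    Live (rateCarriersOfRecord₁₃CoPH 𝔯 F θ hP g₀ os (ksel F θ hP g₀ os)).ne2 ∧ N15At (rateCarriersOfRecord₁₃CoPH 𝔯 F θ hP g₀ os (ksel F θ hP g₀ os)).ne2 := by
  obtain ⟨b, aS, ν, μ, α, β, c35, p, hb, haS, h⟩ := hpin
  show Live (ne2OfRecord₁₁ ((𝔯.lit F θ hP g₀ os).ne2 (ksel F θ hP g₀ os))) ∧ N15At (ne2OfRecord₁₁ ((𝔯.lit F θ hP g₀ os).ne2 (ksel F θ hP g₀ os)))
  rw [h F θ hP g₀ os (ksel F θ hP g₀ os)]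
  exact live_and_n15At_fullGSizedObjects_family hb haS ν μ α β c35 p F

end Pinned

end Summit.QuantumFields.YangMills.BalabanUVNodes.N15.GenuineRecord

end
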